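/-
Copyright (c) 2026 the pub-hodgecm-mathlib formalisation cell (harness21).  Prover seat hodgecm-mathlib-K2E3-p03 (g6), Track B «K2-LIT» ∕ h413
(`stmt-HodgeConjecture-24833`), line `K2_E3_EllipticInputs`, road (11-3-split-nsc), leaf (nsc-S-A′) `sig_K2E3GL3PrincipalBlockStandardSpan` (owner K2E3-p25 (g0)),
line «IH-x×x×x» (lead K2E3-p03 (g6) by D78; dealer K2E3-plan (g4)), brick IH-2b: THE IWAHORI–HECKE OPERATORS `e_{Iw} ∘ π(P_s)` ON `(Ind_B^{GL_n} σ′)^{Iw}` IN COORDINATES.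
2026-09-04.
-/
import Summits.HodgeConjecture.HodgeConjecture.Theorems.K2E3GLnIwahoriHeckeCells     -- ★ IH-2a (this seat): cell values, transversal `{u_{i,i+1}(x̃)}`; brings ★ IH-1
import Literature.NumberTheory.Automorphic.CompactOpenAveragingCompose              -- ★ `Representation.avgProj` kit: `avgProj_eq`, `avgProj_mem_fixedPoints`, `isSmoothVector_avgProj`
import HarnessLib

/-!
# K2_E3 road (h413), leaf (nsc-S-A′), line «IH-x×x×x», brick IH-2b: the Iwahori–Hecke operators `H_s = e_{Iw} ∘ π(P_s)` (`s` an adjacent transposition) on the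
# `Iw`-fixed vectors of `I(χ) = Ind_B^{GL_n(F)} σ′` in the coordinates `f ↦ (f(P_w))_w` — the TWO-CASE FORMULA, commutation with intertwiners, and matrix bookkeeping

Cell `pub/hodgecm-mathlib` (D-0151), Track B, seat K2E3-p03 (g6), LEAD of line «IH-x×x×x» (dealer D78); architect K2E3-p25 (g0∕g1).  `--supports stmt-HodgeConjecture-24833 --as helper`;
THEOREMS ONLY (no definition ∕ instance ∕ notation ∕ named fact ∕ `sorry`); never imports `Cruxes/…/Lines`.  COUNT-NEUTRAL helper, GENERIC in `n`; the `GL₃` sequel IH-2c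
(`K2E3GL3IwahoriHeckeMatrices`) evaluates these formulas into K2E3-p11 (g6)'s literal `6 × 6` matrices of ★ IH-4 `K2E3GL3IwahoriModuleIrreducible.eq_smul_one_of_commute`.

NOTATION (inline).  `I = I(χ) = parabolicIndGL F id (𝟙.twist χ) = smoothIndRep B σ′` (rfl), `Iw = iwahoriGL n F`, `e_{Iw} = I.avgProj Iw` (★ `Representation.avgProj`, the Haar
average over `Iw` as a finite sum), `P_w = permGL w`, `s = Equiv.swap i j` with `j = i + 1`, `q = |𝓀[F]|`, `u_{ij}(x) = transvectionUnit i j _ x`.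

THE MATHEMATICS [IwahoriMatsumoto1965, §3 (Prop. 3.2, Thm. 3.3: the relations `T_s² = (q−1)T_s + q`)]; [Borel1976, §3–§4]; [Casselman1980, §3]; [CartierCorvallis1979, §IV.1].
* §1 `e_K` COMMUTES WITH INTERTWINERS (`apply_avgProj_eq_avgProj_apply`: both sides are the same finite average over a transversal of `K ∕ (K ∩ Stab v)`, ★ `avgProj_eq`),
  (values of finite sums: ★ `Representation.SmoothInd.toFun_sum`).
* §2 **THE TWO-CASE FORMULA** `toFun_avgProj_permGL_swap_apply` for `f ∈ I(χ)^{Iw}` (ANY `χ`): with the transversal `{u_{ij}(x̃) : x ∈ 𝓀}` of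
  `Iw ∕ (Iw ∩ P_s Iw P_s⁻¹)` (★ IH-2a `isLeftTransversal_iwahori_swap`), `(e_{Iw} π(P_s) f)(P_w) = q⁻¹ Σ_{x ∈ 𝓀} f(P_w u_{ij}(x̃) P_s)`, and ★ IH-2a's cell values give
  **`= f(P_{sw})` if `w⁻¹ i < w⁻¹ j`, `= q⁻¹ (f(P_{sw}) + (q − 1) f(P_w))` if `w⁻¹ j < w⁻¹ i`** — i.e. `q·H_s` acts on the coordinate vectors `δ_w` by Iwahori–Matsumoto's
  `T_s δ_w = δ_{sw}` (`ℓ(sw) > ℓ(w)`), `T_s δ_w = q δ_{sw} + (q−1) δ_w` (`ℓ(sw) < ℓ(w)`); `e_{Iw} π(g)` preserves `I^{Iw}` (`avgProj_apply_mem_fixedPoints`).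
* §3 COORDINATES (χ UNRAMIFIED, ★ IH-1 basis `φ_σ`, `φ_σ(P_τ) = [τ = σ]`): every `f ∈ I^{Iw}` is `Σ_σ f(P_σ) • φ_σ` (`eq_sum_toFun_smul_basis`), so a LINEAR operator `A` on `I`
  preserving `I^{Iw}` has `(A f)(P_τ) = Σ_σ (A φ_σ)(P_τ) · f(P_σ)` (`toFun_apply_eq_sum`) and matrices multiply: `(A (B φ_σ))(P_τ) = Σ_ρ (A φ_ρ)(P_τ) (B φ_σ)(P_ρ)`
  (`toFun_apply_apply_eq_sum_mul`) — the dictionary «operators on `I^{Iw}` ↔ `S_n × S_n` matrices, column `σ` = coordinates of the image of `φ_σ`» used by IH-2c∕IH-5.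
HONEST LABEL: HC_CM is proved only modulo the 7 printed citations (2 remaining named inputs: hLiu418 = stmt-HodgeConjecture-24832, h413 = stmt-HodgeConjecture-24833)
until rung 0 closes; count-neutral helper (finite-sum identities; no printed citation is discharged).

## Mathlib ∕ tree search
Tree ★: `Representation.avgProj`∕`avgProj_eq`∕`apply_avgProj`∕`exists_isLeftTransversal`∕`IsLeftTransversal` (CompactOpenAveraging), `avgProj_mem_fixedPoints`∕`isSmoothVector_avgProj`
(CompactOpenAveragingCompose), `isSmooth_smoothInd`∕`toFun_smoothIndRep_apply`∕`SmoothInd.toFun_add∕_smul` (SmoothInduction), `isCompact_iwahoriGL`∕`isOpen_iwahoriGL` (IwahoriGL),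
★ IH-1 `exists_iwahoriBasisFun`∕`eq_of_forall_toFun_permGL_eq`, ★ IH-2a §2–§4.  Mathlib: `Representation.IntertwiningMap.isIntertwining`, `Finset.sum_image`, `Fintype.sum_eq_add_sum_compl`,
`Homeomorph.isOpenMap`.  Dedup: `rg "avgProj_permGL_swap|toFun_apply_eq_sum|apply_avgProj_eq_avgProj_apply"` over `Literature Summits` — no hits.

## References
* [IwahoriMatsumoto1965] N. Iwahori, H. Matsumoto, Publ. Math. IHÉS 25 (1965), §3.  * [Borel1976] A. Borel, Invent. Math. 35 (1976), §3–§4.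
* [Casselman1980] W. Casselman, Compositio Math. 40 (1980), §3.  * [CartierCorvallis1979] P. Cartier, PSPM 33.1 (1979), §IV.1.  * [BernsteinZelevinsky1976] Russian Math. Surveys 31:3, §2.3.
-/

set_option autoImplicit false
-- the mandated namespace repeats the single-problem summit's segment (`HodgeConjecture.HodgeConjecture`)
set_option linter.dupNamespace false

noncomputable section

open Matrix
open scoped MatrixGroups
open Literature.NumberTheory.Automorphic ValuativeRel
open Summit.HodgeConjecture.HodgeConjecture.Cruxes.H413

namespace Summit.HodgeConjecture.HodgeConjecture.Cruxes.H413.K2E3GLnIwahoriHeckeOperators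

/-! ## §1 Generic bookkeeping: `e_K` commutes with intertwiners; values of finite sums -/

section Generic

variable {k : Type*} [Field k] [CharZero k] {G : Type*} [Group G] [TopologicalSpace G] [IsTopologicalGroup G]
  {V : Type*} [AddCommGroup V] [Module k V] {ρ : Representation k G V}

/-- **`e_K` commutes with every intertwining operator**: `Φ (e_K v) = e_K (Φ v)` for `v` smooth and `K` compact — both sides are `#R⁻¹ Σ_{r ∈ R} ρ(r)(·)` over one
transversal `R` of `K ∕ (K ∩ Stab v)` (the stabiliser of `v` also fixes `Φ v`). [cite: BernsteinZelevinsky1976, §2.3] [cite: Casselman1995, §2.1] -/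
theorem apply_avgProj_eq_avgProj_apply {K : Subgroup G} (hK : IsCompact (K : Set G)) (Φ : ρ.IntertwiningMap ρ) {v : V} (hv : ρ.IsSmoothVector v) :
    Φ (ρ.avgProj K v) = ρ.avgProj K (Φ v) := by
  obtain ⟨R, hR⟩ := exists_isLeftTransversal (B := K) hK hv
  have hTv : ∀ t ∈ ρ.stabilizerSubgroup v, ρ t v = v := fun t ht => (ρ.mem_stabilizerSubgroup v t).1 ht
  have hTΦv : ∀ t ∈ ρ.stabilizerSubgroup v, ρ t (Φ v) = Φ v := fun t ht => by rw [← Φ.isIntertwining, hTv t ht]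
  rw [Representation.avgProj_eq hK hv hTv hR, Representation.avgProj_eq hK hv hTΦv hR, map_smul, map_sum]
  simp only [Φ.isIntertwining]

end Generic


/-! ## §2 The two-case formula for `e_{Iw} π(P_s)` on `I(χ)^{Iw}` -/

section TwoCase

variable {F : Type} [Field F] [ValuativeRel F] [TopologicalSpace F] [IsNonarchimedeanLocalField F] {n : ℕ}
  (χ : (Π a : Fin n, GL {i : Fin n // (id : Fin n → Fin n) i = a} F) →* ℂˣ)

/-- A conjugate `g K g⁻¹` (spelled `K.map (conj g)`) of an open subgroup of `GL_n(F)` is open. [folklore] -/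
theorem isOpen_map_conj (K : Subgroup (GL (Fin n) F)) (hK : IsOpen (K : Set (GL (Fin n) F))) (g : GL (Fin n) F) :
    IsOpen ((K.map (MulAut.conj g).toMonoidHom : Subgroup (GL (Fin n) F)) : Set (GL (Fin n) F)) := by
  rw [Subgroup.coe_map]
  have : (⇑(MulAut.conj g).toMonoidHom : GL (Fin n) F → GL (Fin n) F) = (Homeomorph.mulLeft g).trans (Homeomorph.mulRight g⁻¹) := by
    ext x; rfl
  rw [this]
  exact (Homeomorph.isOpenMap _) _ hK

/-- **`e_{Iw} π(g) f` is again `Iw`-fixed** (any `g`, any smooth `f`): the Iwahori–Hecke operators preserve `I^{Iw}`. [cite: IwahoriMatsumoto1965, §3] [cite: Borel1976, §3] -/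
theorem avgProj_apply_mem_fixedPoints (g : GL (Fin n) F)
    (f : Representation.SmoothInd (standardParabolicGL F (id : Fin n → Fin n))
      (Representation.twist (((Representation.trivial ℂ (Π a : Fin n, GL {i : Fin n // (id : Fin n → Fin n) i = a} F) ℂ).twist χ).comp
        (leviProjection F (id : Fin n → Fin n))) (rootDeltaChar (standardParabolicGL F (id : Fin n → Fin n))))) :
    (Representation.parabolicIndGL F (id : Fin n → Fin n)
        ((Representation.trivial ℂ (Π a : Fin n, GL {i : Fin n // (id : Fin n → Fin n) i = a} F) ℂ).twist χ)).avgProj (iwahoriGL n F)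
      (Representation.parabolicIndGL F (id : Fin n → Fin n)
        ((Representation.trivial ℂ (Π a : Fin n, GL {i : Fin n // (id : Fin n → Fin n) i = a} F) ℂ).twist χ) g f) ∈
      (Representation.parabolicIndGL F (id : Fin n → Fin n)
        ((Representation.trivial ℂ (Π a : Fin n, GL {i : Fin n // (id : Fin n → Fin n) i = a} F) ℂ).twist χ)).fixedPoints (iwahoriGL n F) :=
  Representation.avgProj_mem_fixedPoints (isCompact_iwahoriGL n F) ((Representation.isSmooth_smoothInd _ _) _)

/-- **THE TWO-CASE FORMULA** for the Iwahori–Hecke operator `e_{Iw} π(P_s)`, `s = (i, i+1)`, on an `Iw`-fixed `f ∈ I(χ)` (any `χ`), at the point `P_w`: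
`f(P_{sw})` if `w⁻¹ i < w⁻¹ (i+1)`, and `q⁻¹ (f(P_{sw}) + (q−1) f(P_w))` otherwise (`q = |𝓀|`).  Proof: `e_{Iw} π(P_s) f = q⁻¹ Σ_{x ∈ 𝓀} π(u_{i,i+1}(x̃) P_s) f` over ★ IH-2a's
transversal, then ★ IH-2a's cell values term by term (the `x = 0` term and the `q − 1` unit terms in CASE B). [cite: IwahoriMatsumoto1965, §3 Thm. 3.3] [cite: Borel1976, §3–§4]
[cite: Casselman1980, §3] -/
theorem toFun_avgProj_permGL_swap_apply {i j : Fin n} (hij : (j : ℕ) = i + 1) (w : Equiv.Perm (Fin n))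
    {f : Representation.SmoothInd (standardParabolicGL F (id : Fin n → Fin n))
      (Representation.twist (((Representation.trivial ℂ (Π a : Fin n, GL {i : Fin n // (id : Fin n → Fin n) i = a} F) ℂ).twist χ).comp
        (leviProjection F (id : Fin n → Fin n))) (rootDeltaChar (standardParabolicGL F (id : Fin n → Fin n))))}
    (hf : f ∈ (Representation.parabolicIndGL F (id : Fin n → Fin n)
      ((Representation.trivial ℂ (Π a : Fin n, GL {i : Fin n // (id : Fin n → Fin n) i = a} F) ℂ).twist χ)).fixedPoints (iwahoriGL n F)) :
    ((Representation.parabolicIndGL F (id : Fin n → Fin n)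
        ((Representation.trivial ℂ (Π a : Fin n, GL {i : Fin n // (id : Fin n → Fin n) i = a} F) ℂ).twist χ)).avgProj (iwahoriGL n F)
      (Representation.parabolicIndGL F (id : Fin n → Fin n)
        ((Representation.trivial ℂ (Π a : Fin n, GL {i : Fin n // (id : Fin n → Fin n) i = a} F) ℂ).twist χ) (permGL (Equiv.swap i j)) f)).toFun
        (permGL w) =
      if w⁻¹ i < w⁻¹ j then f.toFun (permGL (Equiv.swap i j * w))
      else ((Nat.card 𝓀[F] : ℂ))⁻¹ * (f.toFun (permGL (Equiv.swap i j * w)) + ((Nat.card 𝓀[F] : ℂ) - 1) * f.toFun (permGL w)) := by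
  classical
  haveI : Fintype 𝓀[F] := Fintype.ofFinite _
  have hij' : i < j := Fin.lt_def.2 (by omega)
  -- the open subgroup `T = P_s Iw P_s⁻¹` fixes `π(P_s) f`
  have hTo : IsOpen (((iwahoriGL n F).map (MulAut.conj (permGL (Equiv.swap i j) : GL (Fin n) F)).toMonoidHom : Subgroup (GL (Fin n) F)) :
      Set (GL (Fin n) F)) := isOpen_map_conj _ (isOpen_iwahoriGL n F) _
  have hTv : ∀ t ∈ (iwahoriGL n F).map (MulAut.conj (permGL (Equiv.swap i j) : GL (Fin n) F)).toMonoidHom,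
      Representation.parabolicIndGL F (id : Fin n → Fin n) ((Representation.trivial ℂ _ ℂ).twist χ) t
        (Representation.parabolicIndGL F (id : Fin n → Fin n) ((Representation.trivial ℂ _ ℂ).twist χ) (permGL (Equiv.swap i j)) f) =
      Representation.parabolicIndGL F (id : Fin n → Fin n) ((Representation.trivial ℂ _ ℂ).twist χ) (permGL (Equiv.swap i j)) f := by
    rintro _ ⟨κ, hκ, rfl⟩
    rw [MulEquiv.coe_toMonoidHom, MulAut.conj_apply, ← Module.End.mul_apply, ← map_mul,
      show (permGL (Equiv.swap i j) : GL (Fin n) F) * κ * (permGL (Equiv.swap i j))⁻¹ * permGL (Equiv.swap i j) = permGL (Equiv.swap i j) * κ by group,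
      map_mul, Module.End.mul_apply, (Representation.mem_fixedPoints _ _ _).1 hf κ hκ]
  -- the transversal and `e_{Iw}` as a finite sum over it
  have hR := K2E3GLnIwahoriHeckeCells.isLeftTransversal_iwahori_swap (F := F) (n := n) hij
  rw [Representation.avgProj_eq (isCompact_iwahoriGL n F) hTo hTv hR, Representation.SmoothInd.toFun_smul, Pi.smul_apply, Literature.NumberTheory.Automorphic.Representation.SmoothInd.toFun_sum,
    K2E3GLnIwahoriHeckeCells.card_transversal_eq, Finset.sum_image fun a _ b _ h => K2E3GLnIwahoriHeckeCells.transvectionUnit_liftRes_injective hij'.ne h,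
    smul_eq_mul]
  simp only [← Module.End.mul_apply, ← map_mul]
  simp only [Representation.parabolicIndGL, Representation.toFun_smoothIndRep_apply, ← mul_assoc]
  have hq0 : ((Nat.card 𝓀[F] : ℂ)) ≠ 0 := Nat.cast_ne_zero.2 (Nat.card_pos (α := 𝓀[F])).ne'
  have hcard : (Finset.univ : Finset 𝓀[F]).card = Nat.card 𝓀[F] := by rw [Finset.card_univ, Nat.card_eq_fintype_card]
  by_cases hw : w⁻¹ i < w⁻¹ j
  · -- CASE A: every term is `f(P_{sw})`
    rw [if_pos hw]
    have hterm : ∀ a : 𝓀[F], f.toFun (permGL w * transvectionUnit i j hij'.ne ((liftRes a : 𝒪[F]) : F) * permGL (Equiv.swap i j)) =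
        f.toFun (permGL (Equiv.swap i j * w)) := fun a =>
      K2E3GLnIwahoriHeckeCells.toFun_permGL_mul_transvectionUnit_mul_permGL_swap_of_lt χ w hij'.ne hw _ f
    simp only [hterm, Finset.sum_const, hcard, nsmul_eq_mul]
    field_simp
  · -- CASE B: the `x = 0` term is `f(P_{sw})`, the `q − 1` unit terms are `f(P_w)`
    rw [if_neg hw]
    have hw' : w⁻¹ j < w⁻¹ i := lt_of_le_of_ne (not_lt.1 hw) fun h => hij'.ne' (w⁻¹.injective h)
    congr 1
    rw [Fintype.sum_eq_add_sum_compl (0 : 𝓀[F])]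
    congr 1
    · rw [liftRes_zero, ZeroMemClass.coe_zero, K2E3GLnIwahoriHeckeCells.permGL_mul_transvectionUnit_zero_mul_permGL_swap]
    · have hterm : ∀ a ∈ ({0}ᶜ : Finset 𝓀[F]), f.toFun (permGL w * transvectionUnit i j hij'.ne ((liftRes a : 𝒪[F]) : F) * permGL (Equiv.swap i j)) =
          f.toFun (permGL w) := by
        intro a ha
        rw [Finset.mem_compl, Finset.mem_singleton] at ha
        refine K2E3GLnIwahoriHeckeCells.toFun_permGL_mul_transvectionUnit_mul_permGL_swap_of_gt χ w hij' hw' ?_ hf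
        have hle : valuation F ((liftRes a : 𝒪[F]) : F) ≤ 1 := (Valuation.mem_integer_iff _ _).1 (liftRes a).2
        refine le_antisymm hle (not_lt.1 fun hlt => ha ?_)
        rw [← residue_liftRes a]
        exact (residue_eq_zero_iff_valuation_lt_one _).2 hlt
      rw [Finset.sum_congr rfl hterm, Finset.sum_const, Finset.card_compl, ← Nat.card_eq_fintype_card, Finset.card_singleton, nsmul_eq_mul,
        Nat.cast_sub Nat.card_pos, Nat.cast_one]

end TwoCase

/-! ## §3 Coordinates: expansion in the basis `φ_σ` and the matrix of a linear operator preserving `I^{Iw}` -/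

section Coordinates

variable {F : Type} [Field F] [ValuativeRel F] [TopologicalSpace F] [IsNonarchimedeanLocalField F] {n : ℕ}
  (χ : (Π a : Fin n, GL {i : Fin n // (id : Fin n → Fin n) i = a} F) →* ℂˣ)

/-- **Expansion in the Iwahori basis**: if `φ_σ ∈ I^{Iw}` with `φ_σ(P_τ) = [τ = σ]` (★ IH-1 `exists_iwahoriBasisFun`), then every `f ∈ I^{Iw}` is `Σ_σ f(P_σ) • φ_σ`
(★ IH-1 (M2): same values at every `P_τ`). [cite: Casselman1980, §3] [cite: Borel1976, §3–§4] -/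
theorem eq_sum_toFun_smul_basis
    (φ : Equiv.Perm (Fin n) → Representation.SmoothInd (standardParabolicGL F (id : Fin n → Fin n))
      (Representation.twist (((Representation.trivial ℂ (Π a : Fin n, GL {i : Fin n // (id : Fin n → Fin n) i = a} F) ℂ).twist χ).comp
        (leviProjection F (id : Fin n → Fin n))) (rootDeltaChar (standardParabolicGL F (id : Fin n → Fin n)))))
    (hφ : ∀ σ, φ σ ∈ (Representation.parabolicIndGL F (id : Fin n → Fin n)
      ((Representation.trivial ℂ (Π a : Fin n, GL {i : Fin n // (id : Fin n → Fin n) i = a} F) ℂ).twist χ)).fixedPoints (iwahoriGL n F))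
    (hφv : ∀ σ τ, (φ σ).toFun (permGL τ) = if τ = σ then 1 else 0)
    {f : Representation.SmoothInd (standardParabolicGL F (id : Fin n → Fin n))
      (Representation.twist (((Representation.trivial ℂ (Π a : Fin n, GL {i : Fin n // (id : Fin n → Fin n) i = a} F) ℂ).twist χ).comp
        (leviProjection F (id : Fin n → Fin n))) (rootDeltaChar (standardParabolicGL F (id : Fin n → Fin n))))}
    (hf : f ∈ (Representation.parabolicIndGL F (id : Fin n → Fin n)
      ((Representation.trivial ℂ (Π a : Fin n, GL {i : Fin n // (id : Fin n → Fin n) i = a} F) ℂ).twist χ)).fixedPoints (iwahoriGL n F)) :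
    f = ∑ σ, f.toFun (permGL σ) • φ σ := by
  classical
  refine K2E3GL3IwahoriBruhat.eq_of_forall_toFun_permGL_eq χ hf (Submodule.sum_mem _ fun σ _ => Submodule.smul_mem _ _ (hφ σ)) fun τ => ?_
  rw [Literature.NumberTheory.Automorphic.Representation.SmoothInd.toFun_sum]
  simp only [Representation.SmoothInd.toFun_smul, Pi.smul_apply, hφv, smul_eq_mul, mul_ite, mul_one, mul_zero, Finset.sum_ite_eq, Finset.mem_univ, if_true]

/-- **The value of `A f` from the values of the `A φ_σ`**: for a LINEAR `A` on `I(χ)` and `f ∈ I^{Iw}`, `(A f)(P_τ) = Σ_σ (A φ_σ)(P_τ) · f(P_σ)`.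
[cite: Casselman1980, §3] [cite: IwahoriMatsumoto1965, §3] -/
theorem toFun_apply_eq_sum
    (φ : Equiv.Perm (Fin n) → Representation.SmoothInd (standardParabolicGL F (id : Fin n → Fin n))
      (Representation.twist (((Representation.trivial ℂ (Π a : Fin n, GL {i : Fin n // (id : Fin n → Fin n) i = a} F) ℂ).twist χ).comp
        (leviProjection F (id : Fin n → Fin n))) (rootDeltaChar (standardParabolicGL F (id : Fin n → Fin n)))))
    (hφ : ∀ σ, φ σ ∈ (Representation.parabolicIndGL F (id : Fin n → Fin n)
      ((Representation.trivial ℂ (Π a : Fin n, GL {i : Fin n // (id : Fin n → Fin n) i = a} F) ℂ).twist χ)).fixedPoints (iwahoriGL n F))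
    (hφv : ∀ σ τ, (φ σ).toFun (permGL τ) = if τ = σ then 1 else 0)
    (A : Representation.SmoothInd (standardParabolicGL F (id : Fin n → Fin n))
      (Representation.twist (((Representation.trivial ℂ (Π a : Fin n, GL {i : Fin n // (id : Fin n → Fin n) i = a} F) ℂ).twist χ).comp
        (leviProjection F (id : Fin n → Fin n))) (rootDeltaChar (standardParabolicGL F (id : Fin n → Fin n)))) →ₗ[ℂ]
      Representation.SmoothInd (standardParabolicGL F (id : Fin n → Fin n))
      (Representation.twist (((Representation.trivial ℂ (Π a : Fin n, GL {i : Fin n // (id : Fin n → Fin n) i = a} F) ℂ).twist χ).comp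
        (leviProjection F (id : Fin n → Fin n))) (rootDeltaChar (standardParabolicGL F (id : Fin n → Fin n)))))
    {f : Representation.SmoothInd (standardParabolicGL F (id : Fin n → Fin n))
      (Representation.twist (((Representation.trivial ℂ (Π a : Fin n, GL {i : Fin n // (id : Fin n → Fin n) i = a} F) ℂ).twist χ).comp
        (leviProjection F (id : Fin n → Fin n))) (rootDeltaChar (standardParabolicGL F (id : Fin n → Fin n))))}
    (hf : f ∈ (Representation.parabolicIndGL F (id : Fin n → Fin n)
      ((Representation.trivial ℂ (Π a : Fin n, GL {i : Fin n // (id : Fin n → Fin n) i = a} F) ℂ).twist χ)).fixedPoints (iwahoriGL n F))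
    (τ : Equiv.Perm (Fin n)) :
    (A f).toFun (permGL τ) = ∑ σ, (A (φ σ)).toFun (permGL τ) * f.toFun (permGL σ) := by
  conv_lhs => rw [eq_sum_toFun_smul_basis χ φ hφ hφv hf]
  rw [map_sum, Literature.NumberTheory.Automorphic.Representation.SmoothInd.toFun_sum]
  refine Finset.sum_congr rfl fun σ _ => ?_
  rw [map_smul, Representation.SmoothInd.toFun_smul, Pi.smul_apply, smul_eq_mul, mul_comm]

/-- **Matrices multiply**: for LINEAR `A, B` on `I(χ)` with `B φ_σ ∈ I^{Iw}`, `(A (B φ_σ))(P_τ) = Σ_ρ (A φ_ρ)(P_τ) · (B φ_σ)(P_ρ)` — the `(τ, σ)` entry of the product of the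
matrices `(τ, ρ) ↦ (A φ_ρ)(P_τ)` and `(ρ, σ) ↦ (B φ_σ)(P_ρ)`. [cite: IwahoriMatsumoto1965, §3] [cite: Casselman1980, §3] -/
theorem toFun_apply_apply_eq_sum_mul
    (φ : Equiv.Perm (Fin n) → Representation.SmoothInd (standardParabolicGL F (id : Fin n → Fin n))
      (Representation.twist (((Representation.trivial ℂ (Π a : Fin n, GL {i : Fin n // (id : Fin n → Fin n) i = a} F) ℂ).twist χ).comp
        (leviProjection F (id : Fin n → Fin n))) (rootDeltaChar (standardParabolicGL F (id : Fin n → Fin n)))))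
    (hφ : ∀ σ, φ σ ∈ (Representation.parabolicIndGL F (id : Fin n → Fin n)
      ((Representation.trivial ℂ (Π a : Fin n, GL {i : Fin n // (id : Fin n → Fin n) i = a} F) ℂ).twist χ)).fixedPoints (iwahoriGL n F))
    (hφv : ∀ σ τ, (φ σ).toFun (permGL τ) = if τ = σ then 1 else 0)
    (A B : Representation.SmoothInd (standardParabolicGL F (id : Fin n → Fin n))
      (Representation.twist (((Representation.trivial ℂ (Π a : Fin n, GL {i : Fin n // (id : Fin n → Fin n) i = a} F) ℂ).twist χ).comp
        (leviProjection F (id : Fin n → Fin n))) (rootDeltaChar (standardParabolicGL F (id : Fin n → Fin n)))) →ₗ[ℂ]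
      Representation.SmoothInd (standardParabolicGL F (id : Fin n → Fin n))
      (Representation.twist (((Representation.trivial ℂ (Π a : Fin n, GL {i : Fin n // (id : Fin n → Fin n) i = a} F) ℂ).twist χ).comp
        (leviProjection F (id : Fin n → Fin n))) (rootDeltaChar (standardParabolicGL F (id : Fin n → Fin n)))))
    (hB : ∀ σ, B (φ σ) ∈ (Representation.parabolicIndGL F (id : Fin n → Fin n)
      ((Representation.trivial ℂ (Π a : Fin n, GL {i : Fin n // (id : Fin n → Fin n) i = a} F) ℂ).twist χ)).fixedPoints (iwahoriGL n F))
    (σ τ : Equiv.Perm (Fin n)) :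
    (A (B (φ σ))).toFun (permGL τ) = ∑ ρ', (A (φ ρ')).toFun (permGL τ) * (B (φ σ)).toFun (permGL ρ') :=
  toFun_apply_eq_sum χ φ hφ hφv A (hB σ) τ

end Coordinates

end Summit.HodgeConjecture.HodgeConjecture.Cruxes.H413.K2E3GLnIwahoriHeckeOperators

end
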